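import Literature.Topology.FourManifolds.NullhomotopicNormalFraming
import Literature.Geometry.Symplectic.PlaneRotationOfTwoForm
import Literature.Geometry.Riemannian.TwistorCouplingModel
import HarnessLib

/-!
# Rotation fields of the normal planes from `2`-forms, from frames, and by gluing two pieces

Topic `Literature/Topology/FourManifolds`; sequel to `NullhomotopicNormalFraming.lean`, whose
Kirby-type theorem (`CodimTwoData.exists_framedTube_of_nullhomotopic`: a null-homotopic
codimension-two submanifold with *oriented* normal bundle has a framed tube) takes the orientation
of the normal plane field `F y` as a **rotation field** (`CodimTwoData.IsRotationField`: a
continuous field of rotations by a right angle of the planes `F y`). This file manufactures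
rotation fields:

* `isRotationField_of_eq_or_eq_neg` — the rotation `planeRot (Q y) (o y)` generated by a field of
  `2`-forms `o y` non-degenerate on `F y` (`PlaneRotationOfTwoForm.lean`: McDuff–Salamon's
  `J = (-A²)^{-1/2} A` in the plane), or any continuous field agreeing with it up to sign, is a
  rotation field; `continuousOn_planeRot_Q` — it is continuous where `o` is;
* `planeRot_eq_of_mul_pos` / `planeRot_eq_neg_of_mul_neg` — **the rotation depends only on the
  orientation class of `o|_F`**: two forms generate the same rotation iff they have the same sign
  on one (every) frame of the plane, and opposite rotations otherwise;
* `exists_isRotationField_of_closedCover` — **gluing**: if `S = A ∪ B` with `A, B` closed and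
  `A ∩ B` preconnected, and `o_A`, `o_B` are continuous on `A`, `B` and non-degenerate on the
  normal planes there, then there is a rotation field on all of `S` (on the preconnected overlap
  the two rotations agree up to a *constant* sign `ε`, the comparison sign being locally constant;
  glue `J_A` on `A` with `ε J_B` on `B` by the pasting lemma) — the elementary substitute for
  "a plane bundle over `S = A ∪ B` oriented over `A` and over `B` with connected `A ∩ B` is
  orientable", used for the `2`-sphere covered by two discs;
* `wedgeForm v w` — the `2`-form `½(v♭ ∧ w♭)` of a pair of vectors, continuous in the pair and
  positive on the pair when it is linearly independent (`wedgeForm_apply_self_pos`): a continuous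
  frame of `F` over `A` gives a non-degenerate form field over `A` (`wedgeForm_frame_ne_zero`).

Everything here is proved; no named facts are introduced (D-0026).

## References

* R. C. Kirby, *The Topology of 4-Manifolds*, LNM 1374 (1989), Ch. VIII, Thm. 2 ("Since the
  normal bundle is oriented …"). [Kirby1989]
* D. McDuff, D. Salamon, *Introduction to Symplectic Topology*, 3rd ed. (2017), Prop. 2.5.6.
  [McDuffSalamon2017]
* M. W. Hirsch, *Differential Topology* (1976), Ch. 4 §4 (orientations of vector bundles as
  coherent families of orientations of the fibres; Lemma 4.1). [HirschDT1976]
-/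

open scoped Manifold ContDiff Topology RealInnerProductSpace
open Set Function Module Filter
open Literature.Geometry.Symplectic Literature.Geometry.Riemannian

noncomputable section

namespace Literature.Topology.FourManifolds

/-! ### The rotation of a plane depends only on the orientation class of the form -/

section PlaneRotSign

variable {V : Type*} [NormedAddCommGroup V] [InnerProductSpace ℝ V] [FiniteDimensional ℝ V]
  {W : Submodule ℝ V}

/-- `|a|⁻¹ a = 1` for `a > 0`. [folklore] -/
theorem abs_inv_mul_self_of_pos {a : ℝ} (h : 0 < a) : |a|⁻¹ * a = 1 := by
  rw [abs_of_pos h, inv_mul_cancel₀ h.ne']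

/-- `|a|⁻¹ a = -1` for `a < 0`. [folklore] -/
theorem abs_inv_mul_self_of_neg {a : ℝ} (h : a < 0) : |a|⁻¹ * a = -1 := by
  rw [abs_of_neg h, inv_neg, neg_mul, inv_mul_cancel₀ h.ne]

/-- **`J` on the plane basis, as a signed rotation**: `J x = (α/|α|) (⟪x, u₀⟫ u₁ - ⟪x, u₁⟫ u₀)`.
[folklore] -/
theorem planeRot_apply_eq_sign_smul (hW : finrank ℝ W = 2) (o : V [⋀^Fin 2]→L[ℝ] ℝ) (x : V) :
    planeRot W.starProjection o x = (|planeCoeff hW o|⁻¹ * planeCoeff hW o) •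
      (⟪x, ((planeBasis hW 0 : W) : V)⟫ • ((planeBasis hW 1 : W) : V) -
        ⟪x, ((planeBasis hW 1 : W) : V)⟫ • ((planeBasis hW 0 : W) : V)) := by
  rw [planeRot_apply hW, planeOp_eq_planeBasis hW, smul_smul]

/-- The product of two forms on a projected pair factors through the product of their
coefficients: `o(Qv, Qw) o'(Qv, Qw) = α α' c²`. [folklore] -/
theorem twoForm_mul_twoForm_eq (hW : finrank ℝ W = 2) (o o' : V [⋀^Fin 2]→L[ℝ] ℝ) (v w : V) :
    o ![W.starProjection v, W.starProjection w] * o' ![W.starProjection v, W.starProjection w] =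
      planeCoeff hW o * planeCoeff hW o' *
        (⟪v, ((planeBasis hW 0 : W) : V)⟫ * ⟪w, ((planeBasis hW 1 : W) : V)⟫ -
          ⟪v, ((planeBasis hW 1 : W) : V)⟫ * ⟪w, ((planeBasis hW 0 : W) : V)⟫) ^ 2 := by
  rw [twoForm_starProjection_eq hW o, twoForm_starProjection_eq hW o']
  ring

/-- **Forms of the same sign on one projected pair generate the same rotation.** [folklore] -/
theorem planeRot_eq_of_mul_pos (hW : finrank ℝ W = 2) {o o' : V [⋀^Fin 2]→L[ℝ] ℝ} {v w : V}
    (h : 0 < o ![W.starProjection v, W.starProjection w] * o' ![W.starProjection v, W.starProjection w]) :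
    planeRot W.starProjection o' = planeRot W.starProjection o := by
  rw [twoForm_mul_twoForm_eq hW] at h
  set c : ℝ := ⟪v, ((planeBasis hW 0 : W) : V)⟫ * ⟪w, ((planeBasis hW 1 : W) : V)⟫ -
    ⟪v, ((planeBasis hW 1 : W) : V)⟫ * ⟪w, ((planeBasis hW 0 : W) : V)⟫
  have hprod : 0 < planeCoeff hW o * planeCoeff hW o' := by
    by_contra hle
    nlinarith [sq_nonneg c]
  refine ContinuousLinearMap.ext fun x => ?_
  rw [planeRot_apply_eq_sign_smul hW o, planeRot_apply_eq_sign_smul hW o']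
  congr 1
  rcases lt_or_gt_of_ne (left_ne_zero_of_mul hprod.ne') with hα | hα
  · have hα' : planeCoeff hW o' < 0 := by
      by_contra h'
      nlinarith
    rw [abs_inv_mul_self_of_neg hα, abs_inv_mul_self_of_neg hα']
  · have hα' : 0 < planeCoeff hW o' := by
      by_contra h'
      nlinarith
    rw [abs_inv_mul_self_of_pos hα, abs_inv_mul_self_of_pos hα']

/-- **Forms of opposite signs on one projected pair generate opposite rotations.** [folklore] -/
theorem planeRot_eq_neg_of_mul_neg (hW : finrank ℝ W = 2) {o o' : V [⋀^Fin 2]→L[ℝ] ℝ} {v w : V}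
    (h : o ![W.starProjection v, W.starProjection w] * o' ![W.starProjection v, W.starProjection w] < 0) :
    planeRot W.starProjection o' = -planeRot W.starProjection o := by
  rw [twoForm_mul_twoForm_eq hW] at h
  set c : ℝ := ⟪v, ((planeBasis hW 0 : W) : V)⟫ * ⟪w, ((planeBasis hW 1 : W) : V)⟫ -
    ⟪v, ((planeBasis hW 1 : W) : V)⟫ * ⟪w, ((planeBasis hW 0 : W) : V)⟫
  have hprod : planeCoeff hW o * planeCoeff hW o' < 0 := by
    by_contra hle
    nlinarith [sq_nonneg c]
  refine ContinuousLinearMap.ext fun x => ?_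
  rw [neg_apply, planeRot_apply_eq_sign_smul hW o,
    planeRot_apply_eq_sign_smul hW o', ← neg_smul]
  congr 1
  rcases lt_or_gt_of_ne (left_ne_zero_of_mul hprod.ne) with hα | hα
  · have hα' : 0 < planeCoeff hW o' := by
      by_contra h'
      nlinarith
    rw [abs_inv_mul_self_of_neg hα, abs_inv_mul_self_of_pos hα', neg_neg]
  · have hα' : planeCoeff hW o' < 0 := by
      by_contra h'
      nlinarith
    rw [abs_inv_mul_self_of_pos hα, abs_inv_mul_self_of_neg hα']

/-- If `o` does not vanish on the projected pair `(Qv, Qw)` and `o'` does not vanish on the plane,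
then `o'` does not vanish on `(Qv, Qw)` either (both are multiples of the same coordinate
determinant). [folklore] -/
theorem twoForm_ne_zero_of_ne_zero (hW : finrank ℝ W = 2) {o o' : V [⋀^Fin 2]→L[ℝ] ℝ} {v w : V}
    (h : o ![W.starProjection v, W.starProjection w] ≠ 0)
    (ho' : ∃ v' w', o' ![W.starProjection v', W.starProjection w'] ≠ 0) :
    o' ![W.starProjection v, W.starProjection w] ≠ 0 := by
  rw [twoForm_starProjection_eq hW o] at h
  rw [twoForm_starProjection_eq hW o']
  exact mul_ne_zero (planeCoeff_ne_zero hW o' ho') (right_ne_zero_of_mul h)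

end PlaneRotSign

/-! ### The `2`-form of a pair of vectors -/

section Wedge

variable {V : Type*} [NormedAddCommGroup V] [InnerProductSpace ℝ V] [FiniteDimensional ℝ V]

/-- The continuous bilinear form `(a, b) ↦ ⟪v, a⟫ ⟪w, b⟫` of a pair of vectors. [folklore] -/
def pairBilin (v w : V) : V →L[ℝ] V →L[ℝ] ℝ :=
  ContinuousLinearMap.smulRightL ℝ V (V →L[ℝ] ℝ) (innerSL ℝ v) (innerSL ℝ w)

omit [FiniteDimensional ℝ V] in
/-- `pairBilin v w a b = ⟪v, a⟫ ⟪w, b⟫`. [folklore] -/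
@[simp] theorem pairBilin_apply (v w a b : V) : pairBilin v w a b = ⟪v, a⟫ * ⟪w, b⟫ := by
  simp [pairBilin]

omit [FiniteDimensional ℝ V] in
/-- `pairBilin` is continuous in the pair. [folklore] -/
theorem continuous_pairBilin : Continuous fun p : V × V => pairBilin p.1 p.2 :=
  (ContinuousLinearMap.smulRightL ℝ V (V →L[ℝ] ℝ)).continuous₂.comp
    (((innerSL ℝ).continuous.comp continuous_fst).prodMk ((innerSL ℝ).continuous.comp continuous_snd))

/-- **The `2`-form `½ (v♭ ∧ w♭)` of a pair of vectors**:
`wedgeForm v w (a, b) = ½ (⟪v, a⟫ ⟪w, b⟫ - ⟪v, b⟫ ⟪w, a⟫)`. [folklore] -/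
def wedgeForm (v w : V) : V [⋀^Fin 2]→L[ℝ] ℝ := altOfBilin (pairBilin v w)

omit [FiniteDimensional ℝ V] in
/-- The value of `wedgeForm`. [folklore] -/
theorem wedgeForm_apply (v w a b : V) :
    wedgeForm v w ![a, b] = 2⁻¹ * (⟪v, a⟫ * ⟪w, b⟫ - ⟪v, b⟫ * ⟪w, a⟫) := by
  rw [wedgeForm, altOfBilin_apply, pairBilin_apply, pairBilin_apply]

/-- `wedgeForm` is continuous in the pair. [folklore] -/
theorem continuous_wedgeForm : Continuous fun p : V × V => wedgeForm p.1 p.2 := by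
  have : (fun p : V × V => wedgeForm p.1 p.2) = fun p => altOfBilinCLM (pairBilin p.1 p.2) := by
    funext p; rw [altOfBilinCLM_apply]; rfl
  rw [this]
  exact altOfBilinCLM.continuous.comp continuous_pairBilin

omit [FiniteDimensional ℝ V] in
/-- **`wedgeForm v w` is positive on a pair `(v, w')` with `w'` the component of `w` orthogonal to
`v`, for an independent pair**: `wedgeForm v w (v, w') = ½ ‖v‖² ‖w'‖² > 0`. This is the strict
Cauchy–Schwarz inequality in disguise. [folklore] -/
theorem wedgeForm_apply_self_pos {v w : V} (h : LinearIndependent ℝ ![v, w]) :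
    0 < wedgeForm v w ![v, w - (⟪v, w⟫ / ‖v‖ ^ 2) • v] := by
  have hv : v ≠ 0 := by
    have := h.ne_zero 0
    simpa using this
  have hv2 : 0 < ‖v‖ ^ 2 := by positivity
  set w' : V := w - (⟪v, w⟫ / ‖v‖ ^ 2) • v with hw'
  have hvw' : ⟪v, w'⟫ = 0 := by
    rw [hw', inner_sub_right, real_inner_smul_right, real_inner_self_eq_norm_sq,
      div_mul_cancel₀ _ hv2.ne', sub_self]
  have hww' : ⟪w, w'⟫ = ‖w'‖ ^ 2 := by
    have : w = w' + (⟪v, w⟫ / ‖v‖ ^ 2) • v := by rw [hw']; abel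
    conv_lhs => rw [this]
    rw [inner_add_left, real_inner_smul_left, hvw', mul_zero, add_zero, real_inner_self_eq_norm_sq]
  have hw'0 : w' ≠ 0 := by
    intro h0
    have hdep : w = (⟪v, w⟫ / ‖v‖ ^ 2) • v := by
      rw [← sub_eq_zero]; exact h0
    have h2 := (LinearIndependent.pair_iff.1 h) (⟪v, w⟫ / ‖v‖ ^ 2) (-1)
      (by rw [neg_one_smul, ← hdep]; exact add_neg_cancel w)
    exact absurd h2.2 (by norm_num)
  have hw'2 : 0 < ‖w'‖ ^ 2 := by positivity
  rw [wedgeForm_apply, hvw', zero_mul, sub_zero, real_inner_self_eq_norm_sq, hww']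
  positivity

/-- A frame of a plane makes `wedgeForm` non-degenerate on the projected pairs of the plane.
[folklore] -/
theorem wedgeForm_frame_ne_zero {W : Submodule ℝ V} {v w : V} (hv : v ∈ W) (hw : w ∈ W)
    (h : LinearIndependent ℝ ![v, w]) :
    ∃ a b, wedgeForm v w ![W.starProjection a, W.starProjection b] ≠ 0 := by
  refine ⟨v, w - (⟪v, w⟫ / ‖v‖ ^ 2) • v, ?_⟩
  rw [Submodule.starProjection_eq_self_iff.2 hv,
    Submodule.starProjection_eq_self_iff.2 (W.sub_mem hw (W.smul_mem _ hv))]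
  exact (wedgeForm_apply_self_pos h).ne'

end Wedge

namespace CodimTwoData

variable {k : ℕ} {X : Type*} [TopologicalSpace X] [ChartedSpace (EuclideanSpace ℝ (Fin (k + 2))) X]
  [IsManifold (𝓡 (k + 2)) ∞ X]
  {S : Type*} [TopologicalSpace S] [ChartedSpace (EuclideanSpace ℝ (Fin k)) S] [IsManifold (𝓡 k) ∞ S]
  {V : Type*} [NormedAddCommGroup V] [InnerProductSpace ℝ V] [FiniteDimensional ℝ V]
  (D : CodimTwoData k X S V)

/-! ### Rotation fields generated by `2`-form fields -/

/-- The rotation generated by a form takes values in the normal plane. [folklore] -/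
theorem planeRot_Q_apply_mem (y : S) (o : V [⋀^Fin 2]→L[ℝ] ℝ) (v : V) :
    planeRot (D.Q y) o v ∈ D.F y :=
  planeRot_apply_mem (W := D.F y) v

/-- The rotation generated by a form is skew on the diagonal. [folklore] -/
theorem inner_planeRot_Q_self (y : S) (o : V [⋀^Fin 2]→L[ℝ] ℝ) (v : V) :
    ⟪planeRot (D.Q y) o v, v⟫ = 0 :=
  inner_planeRot_self (W := D.F y) v

/-- The rotation generated by a non-degenerate form preserves the norms of normal vectors.
[folklore] -/
theorem norm_planeRot_Q (y : S) {o : V [⋀^Fin 2]→L[ℝ] ℝ} (ho : ∃ v w, o ![D.Q y v, D.Q y w] ≠ 0)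
    {v : V} (hv : v ∈ D.F y) : ‖planeRot (D.Q y) o v‖ = ‖v‖ := by
  rw [show D.Q y = (D.F y).starProjection from rfl,
    norm_planeRot (W := D.F y) (D.finrank_F_eq_two y) ho, Submodule.starProjection_eq_self_iff.2 hv]

/-- **A continuous field agreeing up to sign with the rotations generated by a non-degenerate form
field is a rotation field.** [folklore] -/
theorem isRotationField_of_eq_or_eq_neg {o : S → V [⋀^Fin 2]→L[ℝ] ℝ}
    (hnd : ∀ y, ∃ v w, o y ![D.Q y v, D.Q y w] ≠ 0) {J : S → V →L[ℝ] V} (hJc : Continuous J)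
    (hJ : ∀ y, J y = planeRot (D.Q y) (o y) ∨ J y = -planeRot (D.Q y) (o y)) :
    D.IsRotationField J := by
  refine ⟨hJc, fun y w => ?_, fun y w hw => ?_, fun y w hw => ?_⟩
  · rcases hJ y with h | h <;> rw [h]
    · exact D.planeRot_Q_apply_mem y _ w
    · rw [neg_apply]
      exact (D.F y).neg_mem (D.planeRot_Q_apply_mem y _ w)
  · rcases hJ y with h | h <;> rw [h]
    · exact D.inner_planeRot_Q_self y _ w
    · rw [neg_apply, inner_neg_left, D.inner_planeRot_Q_self, neg_zero]
  · rcases hJ y with h | h <;> rw [h]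
    · exact D.norm_planeRot_Q y (hnd y) hw
    · rw [neg_apply, norm_neg]
      exact D.norm_planeRot_Q y (hnd y) hw

/-- **The rotation generated by a form field is continuous where the form field is** (and the
form is non-degenerate on the normal plane): `(Q, o) ↦ planeRot Q o` is `C^∞` at non-degenerate
data (`contDiffAt_planeRot`) and `y ↦ Q y` is continuous (`contMDiff_Q`). [folklore] -/
theorem continuousOn_planeRot_Q {A : Set S} {o : S → V [⋀^Fin 2]→L[ℝ] ℝ} (ho : ContinuousOn o A)
    (hnd : ∀ y ∈ A, ∃ v w, o y ![D.Q y v, D.Q y w] ≠ 0) :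
    ContinuousOn (fun y => planeRot (D.Q y) (o y)) A := by
  intro y hy
  have hp : 0 < planeRotSq (D.Q y) (o y) :=
    (planeRotSq_pos_iff (W := D.F y) (D.finrank_F_eq_two y) (o y)).2 (hnd y hy)
  have h1 : ContinuousWithinAt (fun y => (D.Q y, o y)) A y :=
    D.contMDiff_Q.continuous.continuousWithinAt.prodMk (ho y hy)
  exact (contDiffAt_planeRot (p := (D.Q y, o y)) hp).continuousAt.comp_continuousWithinAt
    (f := fun y => (D.Q y, o y)) h1

/-- A form field continuous on `A` is continuous on `A` when evaluated on `(Q y v, Q y w)`.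
[folklore] -/
theorem continuousOn_twoForm_Q {A : Set S} {o : S → V [⋀^Fin 2]→L[ℝ] ℝ} (ho : ContinuousOn o A)
    (v w : V) : ContinuousOn (fun y => o y ![D.Q y v, D.Q y w]) A := by
  have hQ : Continuous fun y => D.Q y := D.contMDiff_Q.continuous
  have h1 : ContinuousOn (fun y => alt2Flat (o y) (D.Q y v) (D.Q y w)) A :=
    (((contDiff_alt2Flat (n := ∞)).continuous.comp_continuousOn ho).clm_apply
      (hQ.clm_apply continuous_const).continuousOn).clm_apply
      (hQ.clm_apply continuous_const).continuousOn
  refine h1.congr fun y _ => ?_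
  simp only [alt2Flat_apply]

/-! ### Gluing two pieces over a preconnected overlap -/

omit [FiniteDimensional ℝ V] in
/-- `x = -x` forces `x = 0` in a real vector space. [folklore] -/
theorem eq_zero_of_eq_neg_self' {x : V} (h : x = -x) : x = 0 := by
  have h2 : (2 : ℝ) • x = 0 := by
    rw [two_smul]
    nth_rewrite 2 [h]
    exact add_neg_cancel x
  exact (smul_eq_zero.1 h2).resolve_left two_ne_zero

/-- The rotation generated by a non-degenerate form is not its own negative. [folklore] -/
theorem planeRot_Q_ne_neg (y : S) {o : V [⋀^Fin 2]→L[ℝ] ℝ} (ho : ∃ v w, o ![D.Q y v, D.Q y w] ≠ 0) :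
    planeRot (D.Q y) o ≠ -planeRot (D.Q y) o := by
  obtain ⟨v, w, hvw⟩ := ho
  have hv : D.Q y v ≠ 0 := by
    intro h0
    apply hvw
    exact o.map_coord_zero (m := ![D.Q y v, D.Q y w]) 0 h0
  intro hJ
  have h1 : planeRot (D.Q y) o (D.Q y v) = -planeRot (D.Q y) o (D.Q y v) := by
    conv_lhs => rw [hJ]
    rfl
  have h2 := eq_zero_of_eq_neg_self' h1
  have h3 := D.norm_planeRot_Q y (o := o) ⟨v, w, hvw⟩ (v := D.Q y v)
    (Submodule.starProjection_apply_mem (D.F y) v)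
  rw [h2, norm_zero] at h3
  exact hv (norm_eq_zero.1 h3.symm)

/-- **Gluing rotation fields over a closed cover with preconnected overlap.** Let `S = A ∪ B` with
`A`, `B` closed and `A ∩ B` preconnected, and let `o_A`, `o_B` be `2`-form fields continuous on
`A`, `B` and non-degenerate on the normal planes there. Then the normal plane field carries a
rotation field. On `A ∩ B` the rotations `J_A`, `J_B` generated by the two forms agree up to a sign
(`planeRot_eq_of_mul_pos` / `planeRot_eq_neg_of_mul_neg`), which is locally constant (the
comparison product `o_A(Qv, Qw) o_B(Qv, Qw)` is continuous and nowhere zero near each point, for a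
pair chosen there), hence constant `= ε` on the preconnected overlap; `J = J_A` on `A` and
`ε J_B` on `B` is then well defined and continuous by the pasting lemma. This is the coherence of
fibre orientations over a connected overlap (Hirsch, Ch. 4 §4). [cite: HirschDT1976, Ch. 4 §4, Lemma 4.1] -/
theorem exists_isRotationField_of_closedCover {A B : Set S} (hA : IsClosed A) (hB : IsClosed B)
    (hAB : A ∪ B = univ) (hconn : IsPreconnected (A ∩ B))
    {oA oB : S → V [⋀^Fin 2]→L[ℝ] ℝ} (hoA : ContinuousOn oA A) (hoB : ContinuousOn oB B)
    (hndA : ∀ y ∈ A, ∃ v w, oA y ![D.Q y v, D.Q y w] ≠ 0)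
    (hndB : ∀ y ∈ B, ∃ v w, oB y ![D.Q y v, D.Q y w] ≠ 0) :
    ∃ J : S → V →L[ℝ] V, D.IsRotationField J := by
  classical
  have hF2 := D.finrank_F_eq_two
  -- the sign relation on the overlap: `J_B = J_A` (`P y`) or `J_B = -J_A`, never both
  let P : S → Prop := fun y => planeRot (D.Q y) (oB y) = planeRot (D.Q y) (oA y)
  have hdich : ∀ y ∈ A ∩ B, P y ∨ planeRot (D.Q y) (oB y) = -planeRot (D.Q y) (oA y) := by
    rintro y ⟨hyA, hyB⟩
    obtain ⟨v, w, hvw⟩ := hndA y hyA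
    have hvw' : oB y ![D.Q y v, D.Q y w] ≠ 0 :=
      twoForm_ne_zero_of_ne_zero (W := D.F y) (hF2 y) hvw (hndB y hyB)
    rcases lt_or_gt_of_ne (mul_ne_zero hvw hvw') with h | h
    · exact Or.inr (planeRot_eq_neg_of_mul_neg (W := D.F y) (hF2 y) h)
    · exact Or.inl (planeRot_eq_of_mul_pos (W := D.F y) (hF2 y) h)
  have hnotboth : ∀ y ∈ A ∩ B, P y → planeRot (D.Q y) (oB y) ≠ -planeRot (D.Q y) (oA y) := by
    rintro y ⟨hyA, -⟩ hP h
    exact D.planeRot_Q_ne_neg y (hndA y hyA) (hP.symm.trans h)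
  -- local constancy of `P` on the overlap
  have hloc : ∀ y₀ ∈ A ∩ B, ∀ᶠ y in 𝓝[A ∩ B] y₀, (P y ↔ P y₀) := by
    rintro y₀ ⟨hy₀A, hy₀B⟩
    obtain ⟨v, w, hvw⟩ := hndA y₀ hy₀A
    have hvw' : oB y₀ ![D.Q y₀ v, D.Q y₀ w] ≠ 0 :=
      twoForm_ne_zero_of_ne_zero (W := D.F y₀) (hF2 y₀) hvw (hndB y₀ hy₀B)
    -- the comparison product is continuous on `A ∩ B` and nonzero at `y₀`
    have hg : ContinuousOn (fun y => oA y ![D.Q y v, D.Q y w] * oB y ![D.Q y v, D.Q y w])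
        (A ∩ B) :=
      ((D.continuousOn_twoForm_Q hoA v w).mono inter_subset_left).mul
        ((D.continuousOn_twoForm_Q hoB v w).mono inter_subset_right)
    rcases lt_or_gt_of_ne (mul_ne_zero hvw hvw') with hneg | hpos
    · have hev : ∀ᶠ y in 𝓝[A ∩ B] y₀,
          oA y ![D.Q y v, D.Q y w] * oB y ![D.Q y v, D.Q y w] < 0 :=
        (hg y₀ ⟨hy₀A, hy₀B⟩).eventually (gt_mem_nhds hneg)
      have hP₀ : ¬ P y₀ := fun hP =>
        hnotboth y₀ ⟨hy₀A, hy₀B⟩ hP (planeRot_eq_neg_of_mul_neg (W := D.F y₀) (hF2 y₀) hneg)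
      filter_upwards [hev, self_mem_nhdsWithin] with y hy hymem
      have hPy : ¬ P y := fun hP =>
        hnotboth y hymem hP (planeRot_eq_neg_of_mul_neg (W := D.F y) (hF2 y) hy)
      exact ⟨fun h => absurd h hPy, fun h => absurd h hP₀⟩
    · have hev : ∀ᶠ y in 𝓝[A ∩ B] y₀,
          0 < oA y ![D.Q y v, D.Q y w] * oB y ![D.Q y v, D.Q y w] :=
        (hg y₀ ⟨hy₀A, hy₀B⟩).eventually (lt_mem_nhds hpos)
      have hP₀ : P y₀ := planeRot_eq_of_mul_pos (W := D.F y₀) (hF2 y₀) hpos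
      filter_upwards [hev] with y hy
      exact ⟨fun _ => hP₀, fun _ => planeRot_eq_of_mul_pos (W := D.F y) (hF2 y) hy⟩
  -- hence constancy on the preconnected overlap
  have hconst : ∀ y₁ ∈ A ∩ B, ∀ y₂ ∈ A ∩ B, (P y₁ ↔ P y₂) := by
    haveI : PreconnectedSpace ↥(A ∩ B) := Subtype.preconnectedSpace hconn
    let f : ↥(A ∩ B) → Prop := fun y => P y
    have hf : IsLocallyConstant f := by
      refine (IsLocallyConstant.iff_eventually_eq f).2 fun y => ?_
      have h := (eventually_nhds_subtype_iff (A ∩ B) y (fun x => (P x ↔ P y))).2 (hloc y y.2)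
      filter_upwards [h] with z hz
      exact propext hz
    intro y₁ h₁ y₂ h₂
    exact Iff.of_eq (hf.apply_eq_of_preconnectedSpace ⟨y₁, h₁⟩ ⟨y₂, h₂⟩)
  -- the global sign: either `P` holds on the whole overlap, or its negation does
  by_cases hall : ∀ y ∈ A ∩ B, P y
  · -- `J = J_A` on `A`, `J_B` on `B`
    let J : S → V →L[ℝ] V := fun y =>
      if y ∈ A then planeRot (D.Q y) (oA y) else planeRot (D.Q y) (oB y)
    have hJA : ∀ y ∈ A, J y = planeRot (D.Q y) (oA y) := fun y hy => if_pos hy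
    have hJB : ∀ y ∈ B, J y = planeRot (D.Q y) (oB y) := by
      intro y hyB
      by_cases hyA : y ∈ A
      · rw [hJA y hyA]; exact (hall y ⟨hyA, hyB⟩).symm
      · exact if_neg hyA
    have hJc : Continuous J := by
      rw [← continuousOn_univ, ← hAB]
      exact ((D.continuousOn_planeRot_Q hoA hndA).congr hJA).union_of_isClosed
        ((D.continuousOn_planeRot_Q hoB hndB).congr hJB) hA hB
    let o : S → V [⋀^Fin 2]→L[ℝ] ℝ := fun y => if y ∈ A then oA y else oB y
    have hnd : ∀ y, ∃ v w, o y ![D.Q y v, D.Q y w] ≠ 0 := by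
      intro y
      by_cases hyA : y ∈ A
      · simp only [o, if_pos hyA]; exact hndA y hyA
      · simp only [o, if_neg hyA]
        have hy : y ∈ A ∪ B := by rw [hAB]; trivial
        exact hndB y (hy.resolve_left hyA)
    refine ⟨J, D.isRotationField_of_eq_or_eq_neg hnd hJc fun y => Or.inl ?_⟩
    by_cases hyA : y ∈ A
    · simp only [J, o, if_pos hyA]
    · simp only [J, o, if_neg hyA]
  · -- `J = J_A` on `A`, `-J_B` on `B`
    push Not at hall
    obtain ⟨y', hy', hP'⟩ := hall
    have hneg : ∀ y ∈ A ∩ B, planeRot (D.Q y) (oB y) = -planeRot (D.Q y) (oA y) := by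
      intro y hy
      have hPy : ¬ P y := fun h => hP' ((hconst y hy y' hy').1 h)
      exact (hdich y hy).resolve_left hPy
    let J : S → V →L[ℝ] V := fun y =>
      if y ∈ A then planeRot (D.Q y) (oA y) else -planeRot (D.Q y) (oB y)
    have hJA : ∀ y ∈ A, J y = planeRot (D.Q y) (oA y) := fun y hy => if_pos hy
    have hJB : ∀ y ∈ B, J y = -planeRot (D.Q y) (oB y) := by
      intro y hyB
      by_cases hyA : y ∈ A
      · rw [hJA y hyA, hneg y ⟨hyA, hyB⟩, neg_neg]
      · exact if_neg hyA
    have hJc : Continuous J := by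
      rw [← continuousOn_univ, ← hAB]
      exact ((D.continuousOn_planeRot_Q hoA hndA).congr hJA).union_of_isClosed
        ((D.continuousOn_planeRot_Q hoB hndB).neg.congr hJB) hA hB
    let o : S → V [⋀^Fin 2]→L[ℝ] ℝ := fun y => if y ∈ A then oA y else oB y
    have hnd : ∀ y, ∃ v w, o y ![D.Q y v, D.Q y w] ≠ 0 := by
      intro y
      by_cases hyA : y ∈ A
      · simp only [o, if_pos hyA]; exact hndA y hyA
      · simp only [o, if_neg hyA]
        have hy : y ∈ A ∪ B := by rw [hAB]; trivial
        exact hndB y (hy.resolve_left hyA)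
    refine ⟨J, D.isRotationField_of_eq_or_eq_neg hnd hJc fun y => ?_⟩
    by_cases hyA : y ∈ A
    · left; simp only [J, o, if_pos hyA]
    · right; simp only [J, o, if_neg hyA]

end CodimTwoData

end Literature.Topology.FourManifolds
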